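import Literature.Probability.Percolation.SlabGluingFact1
import Literature.Probability.Percolation.SharpnessDCTProofs
import Literature.Probability.LatticeModels.WeakBeurlingEstimate
import HarnessLib

/-!
# Newman–Tassion–Wu 2017, §3.2–§3.4: open circuits in annuli of the slab `S_k` surrounding a
# box — circuits, their winding number, the events `𝒜_{m,n}(c)`, the minimal circuit, and the
# blocking property "a path from `B̄_m(c)` to the outside of `B̄_n(c)` meets every surrounding
# circuit of `Ā_{m,n}(c)`"

Topic: `Literature/Probability/Percolation`. Vocabulary file (definitions + their basic API) for
the circuit half of §3 of Newman–Tassion–Wu, *Critical percolation and the minimal spanning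
tree in slabs* (CPAM 70 (2017); arXiv:1512.09107), in the vocabulary of the tree's ports of
Duminil-Copin–Sidoravicius–Tassion 2016 and of NTW §3.2–3.3 (`slab 3 k`, `slabLift`, `sqBox`,
`IsOSAP`, `pathKey`, `minPath`):

* "`B_n(x) = x + [-n,n]²` and `A_{n,m}(x) = B_m(x) ∖ B_n(x)`" (§2, Notation, p. 6) —
  `NTW17.annulus c m n = sqBox c n ∖ sqBox c m` (planar; lifted by `slabLift k`).
* "A circuit is basically a path `(Γ(i))_{i=1}^r` in `S_k`, such that `Γ(1) = Γ(r)`, and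
  `(Γ(i))_{i=1}^{r-1}` is a self avoiding path" (§3.2, p. 11) — `NTW17.IsOpenCircuit k ω A l`:
  a non-empty self-avoiding list of vertices of `A`, consecutive ones joined by open edges, and
  the last joined to the first by an open edge (the list is `(Γ(i))_{i=1}^{r-1}`).
* circuits "that surround the origin (i.e., their projections on `ℤ²` have nonzero winding
  number around the origin)" (§3.2, p. 11) — `NTW17.seqWinding u L` is the winding number of the
  closed planar vertex sequence `L` (consecutive entries equal or adjacent) about `u + (½,½)`, the
  cyclic sum of the tree's `stepWinding` (`PlanarDuality.lean`); `NTW17.Surrounds k c l` says the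
  projection of `l` has nonzero winding number about `c + (½,½)`.
* "`𝒜_{ℓ,2ℓ}` is the event that there exists inside `Ā_{ℓ,2ℓ}` an open circuit surrounding
  `B̄_ℓ`" (Thm. 3.10, p. 12) — `NTW17.circuitAround k c m n`.
* "the minimal open circuit in `Ā_{m,n}` surrounding `B̄_m` (`Γ₁ = ∅` if there is no such
  circuit)" (Thm. 3.8, p. 11) — `NTW17.minCircuit k ω c m n` (minimal for the tree's
  vertex-lexicographic `pathKey`, as `minPath`; NTW's specific ordering "is not important").

PROVED here (the API the renormalisation of Lemma 3.11, Theorem 3.8 and Cor. 3.2 (i) consume):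
monotonicity / locality / measurability / continuity of `circuitAround`; `minCircuit_spec`,
`minCircuit_eq_nil`, `minCircuit_local` (determined by the edges inside `\overline{B_n(c)}`),
`minCircuit_subset`, `reachable_of_mem_minCircuit` (its vertices lie in one open cluster);
and the **blocking property** `exists_mem_of_walk_of_surrounds` / `exists_sameColumn_of_openConnIn`:
a planar lattice walk (resp. an open path of the slab) from `B_m(c)` to the complement of
`B_n(c)` meets the projection of (resp. a column of) every circuit of `Ā_{m,n}(c)` surrounding
`c` — the discrete Jordan-curve fact behind "`{Γ̄₁ ⟷^R Γ̄₂} ⊇ {crossing of R} ∩ {Γ₁, Γ₂ exist}`"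
in the proof of Thm. 3.8 (p. 11: "by the FKG inequality … `≥ f(3n,2m) a(m,n)²`"), proved with
the winding-number machinery of `PlanarDuality.lean` (`walkWinding`, constancy across unused
edges, vanishing outside the shadow).

## Sources

* C. M. Newman, V. Tassion, W. Wu, *Critical percolation and the minimal spanning tree in
  slabs*, Comm. Pure Appl. Math. 70 (2017) 2084–2120, arXiv:1512.09107: §2 Notation (p. 6),
  §3.2 (circuits and their order, p. 11), Theorem 3.8 (p. 11), Theorem 3.10 (p. 12), Lemma 3.11
  (p. 14), Corollary 3.2 (i) (p. 7) [NewmanTassionWu2017].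
* H. Kesten, *Percolation theory for mathematicians*, Birkhäuser 1982, §2.2 (winding numbers of
  lattice circuits; the tree's `PlanarDuality.lean`) [KestenPTM1982].

## Design choices

* Circuits are vertex LISTS without the repeated end point, with the same open-edge convention
  `s(a,b) ∈ ω ∧ a ≠ b` as the tree's `IsOSAP`; lattice adjacency of consecutive vertices is a
  consequence for lattice configurations `ω ⊆ E(S_k)` (a.s.), assumed where projections are used.
* The winding number is attached to the DUAL point `c + (½,½)` (the tree's `walkWinding`
  convention); for a circuit of `Ā_{m,n}(c)`, `m ≥ 1`, this is the winding number about any point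
  of `B_{m}(c)` (constancy, `seqWinding` is invariant along walks avoiding the circuit).
* `Surrounds` is NOT restricted to winding number `±1`; every use needs only `≠ 0`.
-/

noncomputable section

namespace Literature.Probability.Percolation

open MeasureTheory LatticeModels SimpleGraph

namespace NTW17

variable (k : ℕ)

/-! ## Annuli -/

/-- **The planar annulus `A_{m,n}(c) = B_n(c) ∖ B_m(c)`** (points at sup-distance in `(m, n]`
from `c`). [cite: NewmanTassionWu2017, §2 Notation (A_{n,m}(x) = B_m(x) ∖ B_n(x))] -/
def annulus (c : ℤ × ℤ) (m n : ℕ) : Set (ℤ × ℤ) := sqBox c n \ sqBox c m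

variable {k}

/-- `A_{m,n}(c) ⊆ B_n(c)`. [cite: NewmanTassionWu2017, §2 Notation] -/
theorem annulus_subset_sqBox (c : ℤ × ℤ) (m n : ℕ) : annulus c m n ⊆ sqBox c n :=
  fun _ h => h.1

/-- `A_{m,n}(c)` is disjoint from `B_m(c)`. [cite: NewmanTassionWu2017, §2 Notation] -/
theorem disjoint_annulus_sqBox (c : ℤ × ℤ) (m n : ℕ) : Disjoint (annulus c m n) (sqBox c m) :=
  Set.disjoint_sdiff_left

/-- Annuli are finite. [cite: NewmanTassionWu2017, §2 Notation] -/
theorem annulus_finite (c : ℤ × ℤ) (m n : ℕ) : (annulus c m n).Finite :=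
  (sqBox_finite c n).subset (annulus_subset_sqBox c m n)

/-- Annuli grow when the inner radius decreases and the outer radius increases.
[cite: NewmanTassionWu2017, §2 Notation] -/
theorem annulus_mono (c : ℤ × ℤ) {m m' n n' : ℕ} (hm : m' ≤ m) (hn : n ≤ n') :
    annulus c m n ⊆ annulus c m' n' :=
  fun _ h => ⟨sqBox_mono c hn h.1, fun h' => h.2 (sqBox_mono c hm h')⟩

/-- Membership in an annulus, in coordinates. [cite: NewmanTassionWu2017, §2 Notation] -/
theorem mem_annulus_iff (c z : ℤ × ℤ) (m n : ℕ) :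
    z ∈ annulus c m n ↔ (|z.1 - c.1| ≤ n ∧ |z.2 - c.2| ≤ n) ∧ ¬(|z.1 - c.1| ≤ m ∧ |z.2 - c.2| ≤ m) := by
  simp [annulus, sqBox]

variable (k)

/-! ## Circuits -/

/-- **An open circuit inside `A`** (NTW: "a path `(Γ(i))_{i=1}^r` in `S_k`, such that
`Γ(1) = Γ(r)`, and `(Γ(i))_{i=1}^{r-1}` is a self avoiding path", with open edges): the list
`l = (Γ(i))_{i=1}^{r-1}` is non-empty, without repetition, inside `A`, consecutive vertices are
distinct and joined by open edges, and so are the last and the first.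
[cite: NewmanTassionWu2017, §3.2 (circuits, p. 11)] -/
structure IsOpenCircuit (ω : BondConfig (slab 3 k)) (A : Set (slab 3 k)) (l : List (slab 3 k)) :
    Prop where
  /-- self-avoiding -/
  nodup : l.Nodup
  /-- consecutive vertices are joined by open edges -/
  chain : l.IsChain (fun a b => s(a, b) ∈ ω ∧ a ≠ b)
  /-- inside `A` -/
  subset : ∀ x ∈ l, x ∈ A
  /-- non-empty -/
  ne_nil : l ≠ []
  /-- the last vertex is joined to the first by an open edge -/
  closing : ∀ h : l ≠ [], s(l.getLast h, l.head h) ∈ ω ∧ l.getLast h ≠ l.head h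

variable {k}

namespace IsOpenCircuit

variable {ω ω' : BondConfig (slab 3 k)} {A A' : Set (slab 3 k)} {l : List (slab 3 k)}

/-- Open circuits persist in larger configurations. [cite: NewmanTassionWu2017, §3.2 (circuits)] -/
theorem mono (hl : IsOpenCircuit k ω A l) (h : ω ⊆ ω') : IsOpenCircuit k ω' A l :=
  ⟨hl.nodup, hl.chain.imp fun _ _ hab => ⟨h hab.1, hab.2⟩, hl.subset, hl.ne_nil,
    fun hne => ⟨h (hl.closing hne).1, (hl.closing hne).2⟩⟩

/-- Open circuits inside `A` are open circuits inside any `A' ⊇ A`. [cite: NewmanTassionWu2017, §3.2 (circuits)] -/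
theorem mono_set (hl : IsOpenCircuit k ω A l) (h : A ⊆ A') : IsOpenCircuit k ω A' l :=
  ⟨hl.nodup, hl.chain, fun x hx => h (hl.subset x hx), hl.ne_nil, hl.closing⟩

/-- An open circuit all of whose `ω`-open edges between its vertices are `ω'`-open is an
`ω'`-open circuit. [cite: NewmanTassionWu2017, §3.2 (circuits)] -/
theorem of_edges (hl : IsOpenCircuit k ω A l) (h : ∀ a ∈ l, ∀ b ∈ l, s(a, b) ∈ ω → s(a, b) ∈ ω') :
    IsOpenCircuit k ω' A l :=
  ⟨hl.nodup, hl.chain.imp_of_mem_imp fun a b ha hb hab => ⟨h a ha b hb hab.1, hab.2⟩, hl.subset,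
    hl.ne_nil, fun hne => ⟨h _ (List.getLast_mem hne) _ (List.head_mem hne) (hl.closing hne).1,
      (hl.closing hne).2⟩⟩

/-- An open circuit, read as an open self-avoiding path inside `A` (from its first to its last
vertex). [cite: NewmanTassionWu2017, §3.2 (circuits)] -/
theorem isOSAP (hl : IsOpenCircuit k ω A l) : IsOSAP k ω A Set.univ Set.univ l :=
  ⟨hl.nodup, hl.chain, hl.subset, hl.ne_nil, fun _ => Set.mem_univ _, fun _ => Set.mem_univ _⟩

/-- **The vertices of an open circuit lie in one open cluster**: any two are joined by an open
path inside `A`. [cite: NewmanTassionWu2017, §3.2 (circuits)] -/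
theorem openConnIn_of_mem (hl : IsOpenCircuit k ω A l) {a b : slab 3 k} (ha : a ∈ l) (hb : b ∈ l) :
    ω ∈ openConnIn A a b :=
  SlabCriticality.openConnIn_trans (openConnIn_reverse (hl.isOSAP.openConnIn_of_mem ha))
    (hl.isOSAP.openConnIn_of_mem hb)

/-- Any two vertices of an open circuit are joined in the open graph. [cite: NewmanTassionWu2017, §3.2 (circuits)] -/
theorem reachable_of_mem (hl : IsOpenCircuit k ω A l) {a b : slab 3 k} (ha : a ∈ l) (hb : b ∈ l) :
    (openGraph ω).Reachable a b := by
  obtain ⟨_, _, hr⟩ := hl.openConnIn_of_mem ha hb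
  exact hr.map (SimpleGraph.Embedding.induce A).toHom

end IsOpenCircuit

/-! ## Winding numbers of closed vertex sequences; surrounding -/

variable (k)

/-- The planar projection of a slab vertex, as a point of `Site 2 = ℤ²`.
[cite: NewmanTassionWu2017, §2 Notation (π(z), the projection of z onto ℤ²)] -/
def proj (x : slab 3 k) : Site 2 := ts (planar k x)

variable {k}

/-- **The winding number of a closed planar vertex sequence** `L = (L₀, …, L_{r-1})` about the
dual point `u + (½,½)`: the cyclic sum `Σ_i stepWinding u Lᵢ Lᵢ₊₁` (indices mod `r`) of the
tree's signed ray-crossing count (`PlanarDuality.lean`). Consecutive entries of `L` are meant to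
be equal or lattice-adjacent (the projection of a slab circuit repeats a point along vertical
edges; such steps contribute `0`). [cite: NewmanTassionWu2017, §3.2 (winding number around the origin)] [cite: KestenPTM1982, §2.2] -/
def seqWinding (u : Site 2) : List (Site 2) → ℤ
  | [] => 0
  | a :: t => (((a :: t).zip t).map fun q => stepWinding u q.1 q.2).sum +
      stepWinding u ((a :: t).getLast (List.cons_ne_nil a t)) a

variable (k)

/-- **`l` surrounds `c`**: the projection of the slab vertex list `l` on `ℤ²` has nonzero
winding number about `c + (½,½)` (NTW: circuits "that surround the origin (i.e., their
projections on `ℤ²` have nonzero winding number around the origin)").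
[cite: NewmanTassionWu2017, §3.2 (circuits surrounding the origin, p. 11)] -/
def Surrounds (c : ℤ × ℤ) (l : List (slab 3 k)) : Prop :=
  seqWinding (ts c) (l.map (proj k)) ≠ 0

/-! ## The events `𝒜_{m,n}(c)` and the minimal circuit -/

/-- **The event `𝒜_{m,n}(c)`**: "there exists inside `Ā_{m,n}(c)` an open circuit surrounding
`B̄_m(c)`". [cite: NewmanTassionWu2017, Theorem 3.10 (the event 𝒜_{ℓ,2ℓ})] -/
def circuitAround (c : ℤ × ℤ) (m n : ℕ) : Set (BondConfig (slab 3 k)) :=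
  {ω | ∃ l, IsOpenCircuit k ω (slabLift k (annulus c m n)) l ∧ Surrounds k c l}

/-- The set of surrounding open circuits of `Ā_{m,n}(c)` is finite. [cite: NewmanTassionWu2017, §3.2 (circuits)] -/
theorem finite_setOf_circuit (ω : BondConfig (slab 3 k)) (c : ℤ × ℤ) (m n : ℕ) :
    {l | IsOpenCircuit k ω (slabLift k (annulus c m n)) l ∧ Surrounds k c l}.Finite :=
  (finite_setOf_nodup_subset (slabLift_finite k (annulus_finite c m n))).subset
    fun _ hl => ⟨hl.1.nodup, hl.1.subset⟩

/-- **The minimal open circuit `Γ_min` of `Ā_{m,n}(c)` surrounding `B̄_m(c)`** (minimal for the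
tree's vertex-lexicographic `pathKey`); the empty list if there is none (NTW: "`Γ₁ = ∅` if there
is no such circuit"). [cite: NewmanTassionWu2017, Theorem 3.8 (Γ₁, the minimal open circuit)] -/
def minCircuit (ω : BondConfig (slab 3 k)) (c : ℤ × ℤ) (m n : ℕ) : List (slab 3 k) :=
  open scoped Classical in
  if h : ∃ l, IsOpenCircuit k ω (slabLift k (annulus c m n)) l ∧ Surrounds k c l then
    Classical.choose (Set.exists_min_image
      {l | IsOpenCircuit k ω (slabLift k (annulus c m n)) l ∧ Surrounds k c l} (pathKey k)
      (finite_setOf_circuit k ω c m n) h)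
  else []

variable {k}

/-- When a surrounding open circuit exists, `minCircuit` is one of them and its key is minimal.
[cite: NewmanTassionWu2017, Theorem 3.8 (Γ₁, the minimal open circuit)] -/
theorem minCircuit_spec {ω : BondConfig (slab 3 k)} {c : ℤ × ℤ} {m n : ℕ}
    (h : ω ∈ circuitAround k c m n) :
    (IsOpenCircuit k ω (slabLift k (annulus c m n)) (minCircuit k ω c m n) ∧
        Surrounds k c (minCircuit k ω c m n)) ∧
      ∀ l, IsOpenCircuit k ω (slabLift k (annulus c m n)) l → Surrounds k c l →
        pathKey k (minCircuit k ω c m n) ≤ pathKey k l := by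
  have hh : ∃ l, IsOpenCircuit k ω (slabLift k (annulus c m n)) l ∧ Surrounds k c l := h
  rw [minCircuit, dif_pos hh]
  have hs := Classical.choose_spec (Set.exists_min_image
    {l | IsOpenCircuit k ω (slabLift k (annulus c m n)) l ∧ Surrounds k c l} (pathKey k)
    (finite_setOf_circuit k ω c m n) hh)
  exact ⟨hs.1, fun l hl hs' => hs.2 l ⟨hl, hs'⟩⟩

/-- Off the event, `minCircuit` is empty. [cite: NewmanTassionWu2017, Theorem 3.8 ("Γ₁ = ∅ if there is no such circuit")] -/
theorem minCircuit_eq_nil {ω : BondConfig (slab 3 k)} {c : ℤ × ℤ} {m n : ℕ}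
    (h : ω ∉ circuitAround k c m n) : minCircuit k ω c m n = [] := by
  have hh : ¬∃ l, IsOpenCircuit k ω (slabLift k (annulus c m n)) l ∧ Surrounds k c l := fun hh => h hh
  rw [minCircuit, dif_neg hh]

/-- On the event, `minCircuit` is non-empty; so `minCircuit ≠ []` characterises `𝒜_{m,n}(c)`.
[cite: NewmanTassionWu2017, Theorem 3.8 (a(m,n), the probability that Γ₁ exists)] -/
theorem minCircuit_ne_nil_iff {ω : BondConfig (slab 3 k)} {c : ℤ × ℤ} {m n : ℕ} :
    minCircuit k ω c m n ≠ [] ↔ ω ∈ circuitAround k c m n := by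
  constructor
  · intro h
    by_contra h'
    exact h (minCircuit_eq_nil h')
  · intro h
    exact (minCircuit_spec h).1.1.ne_nil

/-- Characterisation of the minimal circuit: the surrounding open circuit with minimal key.
[cite: NewmanTassionWu2017, Theorem 3.8 (Γ₁)] -/
theorem minCircuit_eq_of_min {ω : BondConfig (slab 3 k)} {c : ℤ × ℤ} {m n : ℕ}
    {l : List (slab 3 k)} (hl : IsOpenCircuit k ω (slabLift k (annulus c m n)) l)
    (hs : Surrounds k c l)
    (hmin : ∀ l', IsOpenCircuit k ω (slabLift k (annulus c m n)) l' → Surrounds k c l' →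
      pathKey k l ≤ pathKey k l') :
    minCircuit k ω c m n = l := by
  obtain ⟨⟨h1, h1'⟩, h2⟩ := minCircuit_spec (k := k) ⟨l, hl, hs⟩
  exact pathKey_injective (le_antisymm (h2 l hl hs) (hmin _ h1 h1'))

/-- The vertices of the minimal circuit lie in `Ā_{m,n}(c) ⊆ \overline{B_n(c)}`.
[cite: NewmanTassionWu2017, Theorem 3.8 (Γ₁ ⊆ Ā_{m,n})] -/
theorem minCircuit_subset (ω : BondConfig (slab 3 k)) (c : ℤ × ℤ) (m n : ℕ) :
    ∀ x ∈ minCircuit k ω c m n, x ∈ slabLift k (sqBox c n) := by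
  intro x hx
  by_cases h : ω ∈ circuitAround k c m n
  · exact slabLift_mono k (annulus_subset_sqBox c m n) ((minCircuit_spec h).1.1.subset x hx)
  · rw [minCircuit_eq_nil h] at hx; simp at hx

/-- **The vertices of the minimal circuit lie in one open cluster.** [cite: NewmanTassionWu2017, Theorem 3.8 (Γ₁)] -/
theorem reachable_of_mem_minCircuit {ω : BondConfig (slab 3 k)} {c : ℤ × ℤ} {m n : ℕ}
    {a b : slab 3 k} (ha : a ∈ minCircuit k ω c m n) (hb : b ∈ minCircuit k ω c m n) :
    (openGraph ω).Reachable a b := by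
  by_cases h : ω ∈ circuitAround k c m n
  · exact (minCircuit_spec h).1.1.reachable_of_mem ha hb
  · rw [minCircuit_eq_nil h] at ha; simp at ha

/-! ## Locality, monotonicity, measurability -/

/-- `𝒜_{m,n}(c)` is increasing. [cite: NewmanTassionWu2017, Theorem 3.10 (𝒜 is increasing: "monotonicity … in p")] -/
theorem circuitAround_mono_config {ω ω' : BondConfig (slab 3 k)} (h : ω ⊆ ω') {c : ℤ × ℤ} {m n : ℕ}
    (hω : ω ∈ circuitAround k c m n) : ω' ∈ circuitAround k c m n := by
  obtain ⟨l, hl, hs⟩ := hω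
  exact ⟨l, hl.mono h, hs⟩

/-- `𝒜_{m,n}(c)` is an upper set. [cite: NewmanTassionWu2017, Theorem 3.10] -/
theorem isUpperSet_circuitAround (c : ℤ × ℤ) (m n : ℕ) : IsUpperSet (circuitAround k c m n) :=
  fun _ _ h hω => circuitAround_mono_config h hω

/-- **Monotonicity in the annulus**: a surrounding circuit of `Ā_{m,n}(c)` is one of every larger
annulus `Ā_{m',n'}(c)`, `m' ≤ m`, `n ≤ n'` (same centre). This is what makes
`𝒜_{m, 2^ℓλm} ⊇ ⋃_i 𝒜_{2^iλm, 2^{i+1}λm}` in the proof of Lemma 3.11.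
[cite: NewmanTassionWu2017, §3.4 (proof of Lemma 3.11, eq. (3.77))] -/
theorem circuitAround_mono {c : ℤ × ℤ} {m m' n n' : ℕ} (hm : m' ≤ m) (hn : n ≤ n') :
    circuitAround k c m n ⊆ circuitAround k c m' n' := by
  rintro ω ⟨l, hl, hs⟩
  exact ⟨l, hl.mono_set (slabLift_mono k (annulus_mono c hm hn)), hs⟩

/-- Two configurations agreeing on the edges inside `\overline{B_n(c)}` have the same surrounding
open circuits of `Ā_{m,n}(c)`. [cite: NewmanTassionWu2017, §3.4 (proof of Lemma 3.11, "measurable with respect to the edge variables")] -/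
theorem isOpenCircuit_congr {ω ω' : BondConfig (slab 3 k)} {c : ℤ × ℤ} {m n : ℕ}
    (h : ω ∩ Set.sym2 (slabLift k (sqBox c n)) = ω' ∩ Set.sym2 (slabLift k (sqBox c n)))
    {l : List (slab 3 k)} (hl : IsOpenCircuit k ω (slabLift k (annulus c m n)) l) :
    IsOpenCircuit k ω' (slabLift k (annulus c m n)) l := by
  refine hl.of_edges fun a ha b hb hab => ?_
  have hmem : s(a, b) ∈ Set.sym2 (slabLift k (sqBox c n)) :=
    Set.mk_mem_sym2_iff.2 ⟨slabLift_mono k (annulus_subset_sqBox c m n) (hl.subset a ha),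
      slabLift_mono k (annulus_subset_sqBox c m n) (hl.subset b hb)⟩
  have := (Set.ext_iff.1 h s(a, b)).1 ⟨hab, hmem⟩
  exact this.1

/-- **Locality of `𝒜_{m,n}(c)`**: it is determined by the edges inside `\overline{B_n(c)}`.
[cite: NewmanTassionWu2017, §3.4 (proof of Lemma 3.11)] -/
theorem determinedBy_circuitAround (c : ℤ × ℤ) (m n : ℕ) :
    DeterminedBy (circuitAround k c m n) (Set.sym2 (slabLift k (sqBox c n))) := by
  rw [determinedBy_iff]
  intro ω ω' h
  constructor
  · rintro ⟨l, hl, hs⟩; exact ⟨l, isOpenCircuit_congr h hl, hs⟩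
  · rintro ⟨l, hl, hs⟩; exact ⟨l, isOpenCircuit_congr h.symm hl, hs⟩

/-- **Locality of the minimal circuit**: it is determined by the edges inside `\overline{B_n(c)}`.
[cite: NewmanTassionWu2017, Theorem 3.8 ("measurable with respect to the edge variables in" the annulus)] -/
theorem minCircuit_local {ω ω' : BondConfig (slab 3 k)} {c : ℤ × ℤ} {m n : ℕ}
    (h : ω ∩ Set.sym2 (slabLift k (sqBox c n)) = ω' ∩ Set.sym2 (slabLift k (sqBox c n))) :
    minCircuit k ω c m n = minCircuit k ω' c m n := by
  by_cases hω : ω ∈ circuitAround k c m n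
  · obtain ⟨⟨h1, h1'⟩, h2⟩ := minCircuit_spec hω
    refine (minCircuit_eq_of_min (isOpenCircuit_congr h h1) h1' fun l' hl' hs' => ?_).symm
    exact h2 l' (isOpenCircuit_congr h.symm hl') hs'
  · have hω' : ω' ∉ circuitAround k c m n := fun h' =>
      hω (((determinedBy_iff _ _).1 (determinedBy_circuitAround c m n) ω ω' h).2 h')
    rw [minCircuit_eq_nil hω, minCircuit_eq_nil hω']

/-- `𝒜_{m,n}(c)` is a local event. [cite: NewmanTassionWu2017, §3.4 (proof of Lemma 3.11)] -/
theorem isLocalEvent_circuitAround (c : ℤ × ℤ) (m n : ℕ) : IsLocalEvent (circuitAround k c m n) :=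
  ⟨(finite_sym2 (slabLift_finite k (sqBox_finite c n))).toFinset, by
    rw [Set.Finite.coe_toFinset]; exact determinedBy_circuitAround c m n⟩

/-- `𝒜_{m,n}(c)` is measurable. [cite: NewmanTassionWu2017, Theorem 3.10] -/
theorem measurableSet_circuitAround (c : ℤ × ℤ) (m n : ℕ) : MeasurableSet (circuitAround k c m n) :=
  measurableSet_of_isLocalEvent_holds (isLocalEvent_circuitAround c m n)

/-- `P_p(𝒜_{m,n}(c))` is continuous in `p`. [cite: NewmanTassionWu2017, §3.4 (proof of Lemma 3.13)] -/
theorem continuous_real_circuitAround (c : ℤ × ℤ) (m n : ℕ) :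
    Continuous fun q : unitInterval => (bondPercolation (slabGraph 3 k) q).real (circuitAround k c m n) :=
  continuous_bondPercolation_real_of_isLocalEvent (slabGraph 3 k) (isLocalEvent_circuitAround c m n)

/-- `P_p(𝒜_{m,n}(c))` is monotone in `p`. [cite: NewmanTassionWu2017, Theorem 3.10 ("the monotonicity of P_p[𝒜] in p")] -/
theorem real_circuitAround_mono {p q : unitInterval} (hpq : p ≤ q) (c : ℤ × ℤ) (m n : ℕ) :
    (bondPercolation (slabGraph 3 k) p).real (circuitAround k c m n) ≤
      (bondPercolation (slabGraph 3 k) q).real (circuitAround k c m n) :=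
  DCT16.real_mono_of_isUpperSet (slabGraph 3 k) (isUpperSet_circuitAround c m n)
    (measurableSet_circuitAround c m n) hpq

/-! ## The closed lattice walk under a slab circuit -/

/-- Winding numbers are unchanged by `Walk.copy`. [folklore] -/
private theorem walkWinding_copy {G : SimpleGraph (Site 2)} {a a' b b' : Site 2} (p : G.Walk a b)
    (ha : a = a') (hb : b = b') (u : Site 2) : walkWinding (p.copy ha hb) u = walkWinding p u := by
  subst ha hb; rfl

section Shadow

/-- **Planar shadow of a lazy chain, with its winding.** A list of lattice points whose consecutive
entries are equal or adjacent is traced by a lattice walk through its points whose winding numbers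
are the corresponding lazy sums of `stepWinding`. [cite: KestenPTM1982, §2.2] -/
theorem exists_walk_of_lazyChain :
    ∀ (a : Site 2) (t : List (Site 2)), (a :: t).IsChain (fun x y => x = y ∨ (zdGraph 2).Adj x y) →
      ∃ (e : Site 2) (W : (zdGraph 2).Walk a e), (a :: t).getLast (List.cons_ne_nil a t) = e ∧
        (∀ x ∈ W.support, x ∈ a :: t) ∧
        ∀ u, walkWinding W u = (((a :: t).zip t).map fun q => stepWinding u q.1 q.2).sum := by
  intro a t
  induction t generalizing a with
  | nil =>
    intro _
    exact ⟨a, Walk.nil, rfl, fun x hx => by simpa using hx, fun u => by simp⟩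
  | cons b t ih =>
    intro hc
    rw [List.isChain_cons_cons] at hc
    obtain ⟨e, W, he, hWs, hWw⟩ := ih b hc.2
    have hlast : (a :: b :: t).getLast (List.cons_ne_nil a (b :: t)) = e := by
      rw [List.getLast_cons (List.cons_ne_nil b t)]; exact he
    rcases hc.1 with hab | hab
    · subst hab
      refine ⟨e, W, hlast, fun x hx => ?_, fun u => ?_⟩
      · exact List.mem_cons_of_mem _ (hWs x hx)
      · rw [hWw u]
        simp [stepWinding, upStep]
    · refine ⟨e, Walk.cons hab W, hlast, fun x hx => ?_, fun u => ?_⟩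
      · rw [Walk.support_cons, List.mem_cons] at hx
        rcases hx with rfl | hx
        · simp
        · exact List.mem_cons_of_mem _ (hWs x hx)
      · rw [walkWinding_cons, hWw u]
        simp

/-- Consecutive vertices of an open path of a LATTICE configuration project to equal or adjacent
points of `ℤ²`. [cite: NewmanTassionWu2017, §2 Notation (the projection π)] -/
theorem proj_rel_of_open {ω : BondConfig (slab 3 k)} (hω : ω ⊆ (slabGraph 3 k).edgeSet)
    {x y : slab 3 k} (h : s(x, y) ∈ ω ∧ x ≠ y) : proj k x = proj k y ∨ (zdGraph 2).Adj (proj k x) (proj k y) := by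
  have hadj : (slabGraph 3 k).Adj x y := (SimpleGraph.mem_edgeSet _).1 (hω h.1)
  rcases (zdGraph_three_adj_iff x.1 y.1).1 hadj with ⟨-, hpa⟩ | ⟨hpe, -⟩
  · have hpa' : planarAdj (planar k x) (planar k y) := hpa
    exact Or.inr (adj_ts_of_planarAdj hpa')
  · have hpe' : planar k x = planar k y := hpe
    exact Or.inl (by rw [proj, proj, hpe'])

/-- **The closed walk under a slab circuit.** For a lattice configuration, an open circuit `l`
of the slab projects onto a CLOSED lattice walk of `ℤ²` through the projections of its vertices,
whose winding number about every dual point is `seqWinding` of the projected list.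
[cite: NewmanTassionWu2017, §3.2 (circuits: "their projections on ℤ²")] -/
theorem exists_closedWalk_of_circuit {ω : BondConfig (slab 3 k)} (hω : ω ⊆ (slabGraph 3 k).edgeSet)
    {A : Set (slab 3 k)} {l : List (slab 3 k)} (hl : IsOpenCircuit k ω A l) :
    ∃ (a : Site 2) (P : (zdGraph 2).Walk a a), (∀ z ∈ P.support, ∃ v ∈ l, proj k v = z) ∧
      ∀ u, walkWinding P u = seqWinding u (l.map (proj k)) := by
  obtain ⟨v₀, t, rfl⟩ := List.exists_cons_of_ne_nil hl.ne_nil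
  -- the projected list is a lazy chain
  have hchain : ((v₀ :: t).map (proj k)).IsChain (fun x y => x = y ∨ (zdGraph 2).Adj x y) :=
    List.isChain_map_of_isChain (proj k) (fun _ _ h => proj_rel_of_open hω h) hl.chain
  rw [List.map_cons] at hchain
  obtain ⟨e, W, he, hWs, hWw⟩ := exists_walk_of_lazyChain (proj k v₀) (t.map (proj k)) hchain
  -- the closing step
  have hne : (v₀ :: t) ≠ [] := List.cons_ne_nil v₀ t
  have hcl := hl.closing hne
  have hlast : proj k ((v₀ :: t).getLast hne) = e := by
    rw [← he]
    exact (List.getLast_map (f := proj k) (l := v₀ :: t) (by simp)).symm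
  have hhead : (v₀ :: t).head hne = v₀ := rfl
  rw [hhead] at hcl
  have hsupp : ∀ z ∈ W.support, ∃ v ∈ v₀ :: t, proj k v = z := by
    intro z hz
    have := hWs z hz
    rw [← List.map_cons, List.mem_map] at this
    exact this
  rcases proj_rel_of_open hω hcl with heq | hadj
  · -- the last vertex sits over the first: the walk is already closed
    rw [hlast] at heq
    refine ⟨proj k v₀, W.copy rfl heq, fun z hz => hsupp z (by simpa using hz), fun u => ?_⟩
    rw [walkWinding_copy, hWw u, List.map_cons, seqWinding]
    have h0 : stepWinding u (((proj k v₀) :: t.map (proj k)).getLast (List.cons_ne_nil _ _)) (proj k v₀) = 0 := by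
      have : ((proj k v₀) :: t.map (proj k)).getLast (List.cons_ne_nil _ _) = e := he
      rw [this, heq]
      simp [stepWinding, upStep]
    rw [h0, add_zero]
  · -- close up with the edge from the last vertex to the first
    rw [hlast] at hadj
    refine ⟨proj k v₀, W.append (Walk.cons hadj Walk.nil), fun z hz => ?_, fun u => ?_⟩
    · rw [Walk.mem_support_append_iff] at hz
      rcases hz with hz | hz
      · exact hsupp z hz
      · simp only [Walk.support_cons, Walk.support_nil, List.mem_cons, List.not_mem_nil, or_false] at hz
        rcases hz with rfl | rfl
        · exact ⟨(v₀ :: t).getLast hne, List.getLast_mem hne, hlast⟩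
        · exact ⟨v₀, by simp, rfl⟩
    · rw [walkWinding_append, walkWinding_cons, walkWinding_nil, add_zero, hWw u, List.map_cons,
        seqWinding]
      have : ((proj k v₀) :: t.map (proj k)).getLast (List.cons_ne_nil _ _) = e := he
      rw [this]

end Shadow

/-! ## The blocking property of surrounding circuits -/

section Blocking

/-- **A surrounding closed walk blocks** (discrete Jordan curve, winding-number form): if a closed
lattice walk `P` inside the annulus `A_{m,n}(c)` has nonzero winding number about `c + (½,½)`, then
every lattice walk from a point of `B_m(c)` to a point outside `B_n(c)` meets `P`.  (Winding is
constant along walks avoiding `P`; it equals its value at `c` on `B_m(c)` and vanishes outside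
`B_n(c)`.) [cite: KestenPTM1982, §2.2] [cite: NewmanTassionWu2017, Theorem 3.8 (proof: a crossing of R meets Γ̄₁)] -/
theorem exists_mem_support_of_winding_ne_zero {a c' d : Site 2} (P : (zdGraph 2).Walk a a)
    {c : ℤ × ℤ} {m n : ℕ} (hP : ∀ z ∈ P.support, (z 0, z 1) ∈ annulus c m n)
    (hw : walkWinding P (ts c) ≠ 0) (Q : (zdGraph 2).Walk c' d)
    (hc' : (c' 0, c' 1) ∈ sqBox c m) (hd : (d 0, d 1) ∉ sqBox c n) :
    ∃ z ∈ Q.support, z ∈ P.support := by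
  -- `P` lives in the box of radius `n` about `ts c`, `d` does not
  have hP' : ∀ z ∈ P.support, z ∈ WeakBeurling.sqBox (ts c) (n : ℤ) := by
    intro z hz
    have := (hP z hz).1
    simp only [sqBox, Set.mem_setOf_eq] at this
    simpa [WeakBeurling.mem_sqBox] using this
  have hd' : d ∉ WeakBeurling.sqBox (ts c) (n : ℤ) := by
    simpa [WeakBeurling.mem_sqBox, sqBox] using hd
  -- prefix from the centre to `c'` inside `B_m(c)`, which avoids `P`
  have hc0 : c ∈ sqBox c m := by simp [sqBox]
  obtain ⟨W, hW⟩ := exists_walk_in_sqBox hc0 hc'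
  have hts : ts (c' 0, c' 1) = c' := by rw [Site.eq_iff_two]; simp
  have hW' : ∀ z ∈ W.support, z ∉ P.support := by
    intro z hz hzP
    obtain ⟨v, hv, rfl⟩ := hW z hz
    have := hP _ hzP
    simp only [ts_apply_zero, ts_apply_one, Prod.mk.eta] at this
    exact (disjoint_annulus_sqBox c m n).le_bot ⟨this, hv⟩
  obtain ⟨z, hz, hzP⟩ := WeakBeurling.exists_mem_support_of_walkWinding_ne_zero hP' hw hd'
    ((W.copy rfl hts).append Q)
  rw [Walk.mem_support_append_iff, Walk.support_copy] at hz
  rcases hz with hz | hz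
  · exact absurd hzP (hW' z hz)
  · exact ⟨z, hz, hzP⟩

/-- **An open path from `B̄_m(c)` to the outside of `B̄_n(c)` passes through a column of every
surrounding open circuit of `Ā_{m,n}(c)`** (lattice configurations): some vertex of the path and
some vertex of the circuit have the same planar projection.  This is the step
"`{L(R) ⟷^R R(R)} ∩ {Γ₁ exists} ⊆ {Γ̄₁ ⟷^R …}`" of the proof of Theorem 3.8.
[cite: NewmanTassionWu2017, Theorem 3.8 (proof, "by using the FKG inequality")] -/
theorem exists_sameColumn_of_isOSAP {ω : BondConfig (slab 3 k)} (hω : ω ⊆ (slabGraph 3 k).edgeSet)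
    {c : ℤ × ℤ} {m n : ℕ} {l : List (slab 3 k)}
    (hl : IsOpenCircuit k ω (slabLift k (annulus c m n)) l) (hs : Surrounds k c l)
    {S X Y : Set (slab 3 k)} {l' : List (slab 3 k)} (hl' : IsOSAP k ω S X Y l')
    (hhead : planar k (l'.head hl'.ne_nil) ∈ sqBox c m)
    (hlast : planar k (l'.getLast hl'.ne_nil) ∉ sqBox c n) :
    ∃ w ∈ l', ∃ v ∈ l, planar k w = planar k v := by
  obtain ⟨a, P, hPs, hPw⟩ := exists_closedWalk_of_circuit hω hl
  have hne := hl'.ne_nil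
  obtain ⟨x₀, t, rfl⟩ := List.exists_cons_of_ne_nil hl'.ne_nil
  obtain ⟨e, W, he, hW⟩ := exists_walk_of_chain hω x₀ t hl'.chain
  have hP : ∀ z ∈ P.support, (z 0, z 1) ∈ annulus c m n := by
    intro z hz
    obtain ⟨v, hv, rfl⟩ := hPs z hz
    have := hl.subset v hv
    simpa [proj, ts, planar] using this
  have hw : walkWinding P (ts c) ≠ 0 := by rw [hPw]; exact hs
  have hx₀ : (x₀ :: t).head hne = x₀ := rfl
  have hc' : ((ts (planar k x₀)) 0, (ts (planar k x₀)) 1) ∈ sqBox c m := by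
    rw [hx₀] at hhead; simpa using hhead
  have hd : ((ts (planar k e)) 0, (ts (planar k e)) 1) ∉ sqBox c n := by
    rw [he] at hlast; simpa using hlast
  obtain ⟨z, hzW, hzP⟩ := exists_mem_support_of_winding_ne_zero P hP hw W hc' hd
  obtain ⟨w, hw', hwz⟩ := hW z hzW
  obtain ⟨v, hv, hvz⟩ := hPs z hzP
  refine ⟨w, hw', v, hv, ts_injective ?_⟩
  rw [hwz, ← hvz, proj]

end Blocking

/-! ## Translation covariance: circuits, winding numbers, `𝒜_{m,n}(c)` and `Γ_min` under `planarShift` -/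

section Shift

variable (v : ℤ × ℤ)

/-- The planar projection of a translated vertex is the translated projection. [folklore] -/
private theorem proj_slabEquiv_planarShift (x : slab 3 k) :
    proj k (slabEquiv k (planarShift v) x) = proj k x + ts v := by
  rw [proj, planar_slabEquiv, planarShift_apply, proj, Site.eq_iff_two]
  simp [ts]

/-- `stepWinding` is invariant under simultaneous translation of the base point and the step.
[cite: KestenPTM1982, §2.2] -/
private theorem stepWinding_add (u x y w : Site 2) : stepWinding (u + w) (x + w) (y + w) = stepWinding u x y := by
  unfold stepWinding upStep
  simp only [Pi.add_apply]
  split_ifs <;> omega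

/-- **The winding number is translation invariant**: translating the sequence and the base point
by the same vector does not change `seqWinding`. [cite: NewmanTassionWu2017, §3.2 (winding number)] [cite: KestenPTM1982, §2.2] -/
theorem seqWinding_map_add (u w : Site 2) (L : List (Site 2)) :
    seqWinding (u + w) (L.map (· + w)) = seqWinding u L := by
  cases L with
  | nil => rfl
  | cons a t =>
    -- the inner lazy sum
    have key : ∀ (a : Site 2) (t : List (Site 2)),
        ((((a :: t).map (· + w)).zip (t.map (· + w))).map fun q => stepWinding (u + w) q.1 q.2).sum =
          (((a :: t).zip t).map fun q => stepWinding u q.1 q.2).sum := by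
      intro a t
      induction t generalizing a with
      | nil => simp
      | cons b t ih =>
        have hb := ih b
        simp only [List.map_cons, List.zip_cons_cons, List.sum_cons] at hb ⊢
        rw [hb, stepWinding_add]
    have hlast : (((a :: t).map (· + w)).getLast (by simp)) = (a :: t).getLast (List.cons_ne_nil a t) + w :=
      List.getLast_map (by simp)
    have hL : seqWinding (u + w) ((a :: t).map (· + w)) =
        ((((a :: t).map (· + w)).zip (t.map (· + w))).map fun q => stepWinding (u + w) q.1 q.2).sum +
          stepWinding (u + w) (((a :: t).map (· + w)).getLast (by simp)) (a + w) := by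
      simp only [List.map_cons, seqWinding]
    rw [hL, key, hlast, stepWinding_add]
    simp only [seqWinding]

/-- Open circuits are transported by planar translations: `l ↦ l.map φ`, `ω ↦ φ·ω`, `A ↦ φ '' A`.
[cite: NewmanTassionWu2017, §3.2 (circuits; translation invariance)] -/
theorem IsOpenCircuit.map_shift {ω : BondConfig (slab 3 k)} {A : Set (slab 3 k)} {l : List (slab 3 k)}
    (hl : IsOpenCircuit k ω A l) :
    IsOpenCircuit k (slabRelabel k (planarShift v) ω) (slabEquiv k (planarShift v) '' A)
      (l.map (slabEquiv k (planarShift v))) := by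
  set φ := slabEquiv k (planarShift v) with hφ
  have hedge : ∀ a b : slab 3 k, s(φ a, φ b) ∈ slabRelabel k (planarShift v) ω ↔ s(a, b) ∈ ω := by
    intro a b
    rw [BondConfig.mem_relabel_iff, sym2Equiv_symm, sym2Equiv_mk, Equiv.symm_apply_apply,
      Equiv.symm_apply_apply]
  refine ⟨hl.nodup.map φ.injective, ?_, ?_, by simpa using hl.ne_nil, fun hne => ?_⟩
  · exact List.isChain_map_of_isChain φ (fun a b hab => ⟨(hedge a b).2 hab.1, fun h => hab.2 (φ.injective h)⟩) hl.chain
  · intro x hx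
    rw [List.mem_map] at hx
    obtain ⟨y, hy, rfl⟩ := hx
    exact Set.mem_image_of_mem φ (hl.subset y hy)
  · have hne' : l ≠ [] := hl.ne_nil
    rw [List.getLast_map, List.head_map]
    exact ⟨(hedge _ _).2 (hl.closing hne').1, fun h => (hl.closing hne').2 (φ.injective h)⟩

/-- `Surrounds` is transported by planar translations. [cite: NewmanTassionWu2017, §3.2 (winding number)] -/
theorem surrounds_map_shift_iff (c : ℤ × ℤ) (l : List (slab 3 k)) :
    Surrounds k (c + v) (l.map (slabEquiv k (planarShift v))) ↔ Surrounds k c l := by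
  unfold Surrounds
  rw [List.map_map]
  have h1 : (proj k ∘ slabEquiv k (planarShift v)) = (· + ts v) ∘ proj k := by
    funext x; simp [Function.comp, proj_slabEquiv_planarShift]
  have h2 : ts (c + v) = ts c + ts v := by rw [Site.eq_iff_two]; simp [ts]
  rw [h1, ← List.map_map, h2, seqWinding_map_add]

/-- Translates of annuli. [cite: NewmanTassionWu2017, §2 Notation] -/
theorem image_planarShift_annulus (c : ℤ × ℤ) (m n : ℕ) :
    planarShift v '' annulus c m n = annulus (c + v) m n := by
  ext w
  rw [Set.mem_image_equiv]
  simp only [annulus, Set.mem_sdiff, sqBox, Set.mem_setOf_eq, planarShift, Equiv.addRight_symm,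
    Equiv.coe_addRight, Prod.fst_add, Prod.snd_add, Prod.fst_neg, Prod.snd_neg]
  have h1 : w.1 + -v.1 - c.1 = w.1 - (c.1 + v.1) := by ring
  have h2 : w.2 + -v.2 - c.2 = w.2 - (c.2 + v.2) := by ring
  rw [h1, h2]

/-- **Transport of `𝒜_{m,n}(c)` under a planar translation**: `{ω | v·ω ∈ 𝒜_{m,n}(c + v)} = 𝒜_{m,n}(c)`.
[cite: NewmanTassionWu2017, Theorem 3.10 (translation invariance of P_p[𝒜])] -/
theorem preimage_slabRelabel_circuitAround (c : ℤ × ℤ) (m n : ℕ) :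
    slabRelabel k (planarShift v) ⁻¹' circuitAround k (c + v) m n = circuitAround k c m n := by
  ext ω
  rw [Set.mem_preimage]
  constructor
  · rintro ⟨l, hl, hs⟩
    -- transport back along `-v`
    have hl' := hl.map_shift (k := k) (-v)
    have hω : slabRelabel k (planarShift (-v)) (slabRelabel k (planarShift v) ω) = ω := by
      ext e
      rw [BondConfig.mem_relabel_iff, BondConfig.mem_relabel_iff, sym2Equiv_symm, sym2Equiv_symm]
      induction e using Sym2.ind with
      | h a b =>
        simp only [sym2Equiv_mk]
        congr! 2 <;> (apply Subtype.ext; funext j; fin_cases j <;> simp [slabEquiv, planar, planarShift])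
    have hA : slabEquiv k (planarShift (-v)) '' slabLift k (annulus (c + v) m n) = slabLift k (annulus c m n) := by
      rw [image_slabEquiv_slabLift, image_planarShift_annulus, add_neg_cancel_right]
    rw [hω, hA] at hl'
    refine ⟨_, hl', ?_⟩
    have := (surrounds_map_shift_iff (k := k) (-v) (c + v) l).2 hs
    rwa [add_neg_cancel_right] at this
  · rintro ⟨l, hl, hs⟩
    refine ⟨l.map (slabEquiv k (planarShift v)), ?_, (surrounds_map_shift_iff v c l).2 hs⟩
    have := hl.map_shift (k := k) v
    rwa [image_slabEquiv_slabLift, image_planarShift_annulus] at this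

/-- **`P_p(𝒜_{m,n}(c))` does not depend on the centre.** [cite: NewmanTassionWu2017, Theorem 3.10 (translation invariance)] -/
theorem real_circuitAround_eq_zero_centre (p : unitInterval) (c : ℤ × ℤ) (m n : ℕ) :
    (bondPercolation (slabGraph 3 k) p).real (circuitAround k c m n) =
      (bondPercolation (slabGraph 3 k) p).real (circuitAround k 0 m n) := by
  rw [← real_preimage_slabRelabel k (planarShift c) (planarAdj_planarShift c) p (circuitAround k c m n)]
  congr 1
  have h := preimage_slabRelabel_circuitAround (k := k) c 0 m n
  rwa [zero_add] at h

end Shift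

end NTW17

end Literature.Probability.Percolation

end
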